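import Mathlib

/-!
# `MatrixDescartes` — sector vocabulary of line «finite» (val-idea-6 g3): the real-rooted-simple SECTOR, the sector
# row `HypRootLawAt`, full positive-rootedness, the STAMP row, H3 and its stamp reading

HONEST FRAMING.  Definitions-only companion (D-0009) for the port of the THEOREMS of the crux workfile
`Cruxes/MatrixDescartes/Lines/finite.lean` (val-idea-6 g3, lens = reduction-to-finite; critic verdict #23 = PASS,
instrument + structure tier, no law posited) into `Theorems/` (desk pub-symmetroid R2428 (C): porter = val-sym-eng-3).
Crux: `Summit.ValiantsHypothesis.ValiantsHypothesis.Theses.LacunarySymmetroid.MatrixDescartes`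
(`stmt-ValiantsHypothesis-18050`), asymptotic in `K`.  NOTHING is proved or claimed here; nothing here bears on the
crux or on `VP ≠ VNP`.  `HyperbolicLaw` (H3 of the g2 door «hyperbolic») is an OPEN law recorded as a `def`, never
asserted.

Why these definitions are declared here and not reused: the only Theorems file in the sector currency,
`Theorems/MatrixDescartes/Negative/MatrixDescartesHypRootLawAtTwoFour.lean` (p595372), deliberately UNFOLDS
`HypRootLawAt` / `IsRealRootedSimple` in its statements (crux workfiles are not importable from `Theorems/`), so there
is no declaration to import; the workfiles `Lines/hyperbolic.lean`, `Lines/amplify.lean`, `Lines/finite.lean`,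
`Lines/stamp.lean` each re-declare them locally for the same reason.  This file gives them ONE importable home, with
the workfiles' texts verbatim, so that the ported theorems (`…FiniteSector.lean`, `…FiniteSectorCertificates.lean`)
and later ports of «stamp» can share them.  `pencil d S` is the census polynomial matrix
`∑ l, X ^ (d l) • (S l).map C` written once as an `abbrev` (it unfolds by `rfl` to the expression the census files
`…CensusDefs` / `…CensusCertificates` / `…DegreeCeiling` spell out).
[folklore] Elementary real-polynomial vocabulary (distinct real roots, Descartes/postage-stamp bookkeeping).
-/

-- `Summit.ValiantsHypothesis.ValiantsHypothesis.…` repeats a component by the D-0017 layout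
-- (single-conjunct summit), which the `dupNamespace` linter flags; the name is mandated.
set_option linter.dupNamespace false

noncomputable section

namespace Summit.ValiantsHypothesis.ValiantsHypothesis.Theorems.LacunarySymmetroidMatrixDescartes.FiniteSector

open scoped BigOperators Matrix
open Polynomial

/-- The lacunary symmetric pencil `F_{d,S}(X) = Σ_l X^{d l} S_l` as a polynomial matrix (census currency: this is the
expression `∑ l, X ^ (d l) • (S l).map C` of `…CensusDefs.RealRootLawAt`, named). [folklore] -/
abbrev pencil {m K : ℕ} (d : Fin K → ℕ) (S : Fin K → Matrix (Fin m) (Fin m) ℝ) :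
    Matrix (Fin m) (Fin m) ℝ[X] :=
  ∑ l, ((Polynomial.X : ℝ[X]) ^ d l) • (S l).map Polynomial.C

/-- **The sector** (line «hyperbolic», verbatim): `p` has `natDegree p` distinct real roots — for `p ≠ 0`, all roots
real and simple ("real-rooted simple", "hyperbolic with simple spectrum"); `p = 0` and non-zero constants qualify
vacuously. [folklore] -/
def IsRealRootedSimple (p : ℝ[X]) : Prop := p.roots.toFinset.card = p.natDegree

/-- **Sector row** «`η(m,K) ≤ B`» (line «hyperbolic», verbatim): every real symmetric `(m,K)` lacunary pencil whose
determinant lies in the sector has determinant of degree `≤ B`.  (`Theorems/…/MatrixDescartesHypRootLawAtTwoFour`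
refutes the row `(2,4,13)` with this predicate unfolded.) [folklore] -/
def HypRootLawAt (m K B : ℕ) : Prop :=
  ∀ (d : Fin K → ℕ) (S : Fin K → Matrix (Fin m) (Fin m) ℝ), (∀ l, (S l).IsSymm) →
    IsRealRootedSimple (pencil d S).det → (pencil d S).det.natDegree ≤ B

/-- **Full positive-rootedness** (line «finite» / «stamp», verbatim): `natDegree p` distinct POSITIVE roots (so, for
`p ≠ 0`, all roots real, positive and simple; `p = 0` and constants qualify vacuously). [folklore] -/
def IsFullPosRooted (p : ℝ[X]) : Prop := (p.roots.filter (0 < ·)).toFinset.card = p.natDegree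

/-- **Stamp row** «`ν(m,K) ≤ B`» (line «finite» / «stamp», verbatim): every full-positive-rooted determinant of a
symmetric `(m,K)` half-pencil has degree `≤ B`. [folklore] -/
def StampLawAt (m K B : ℕ) : Prop :=
  ∀ (d : Fin K → ℕ) (S : Fin K → Matrix (Fin m) (Fin m) ℝ), (∀ l, (S l).IsSymm) →
    IsFullPosRooted (pencil d S).det → (pencil d S).det.natDegree ≤ B

/-- **H3 of the door «hyperbolic»** (`Lines/hyperbolic.lean`, verbatim): the crux `MatrixDescartes` with `q = 2`
restricted to the sector — OPEN, recorded as a proposition, never asserted.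
[conjecture of the cell's line «hyperbolic» (val-idea-6 g2); no citation exists] -/
def HyperbolicLaw : Prop :=
  ∀ c : ℕ, ∃ K₀ : ℕ, ∀ K m : ℕ, K₀ ≤ K → m ≤ 2 ^ ((Nat.log 2 K + c) ^ c) →
    ∀ (d : Fin K → ℕ) (S : Fin K → Matrix (Fin m) (Fin m) ℝ), (∀ l, (S l).IsSymm) →
      IsRealRootedSimple (pencil d S).det → (pencil d S).det.natDegree ^ 2 ≤ 2 ^ (K * Nat.log 2 K)

/-- **Stamp non-realisability at quasi-polynomial size** (line «finite», verbatim) — what H3 says about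
full-positive-rooted half-pencils: `(2·deg q)² ≤ 2^{K⌊log₂K⌋}` for every full-positive-rooted symmetric `(m,K)`
half-pencil determinant `q`, `K ≥ K₀(c)`, `m ≤ 2^{(log K + c)^c}` (proved from `HyperbolicLaw` by doubling in
`…FiniteSector.stampNonRealisability_of_hyperbolicLaw`; OPEN on its own).
[statement of the cell's line «finite» (val-idea-6 g3); no citation exists] -/
def StampNonRealisability : Prop :=
  ∀ c : ℕ, ∃ K₀ : ℕ, ∀ K m : ℕ, K₀ ≤ K → m ≤ 2 ^ ((Nat.log 2 K + c) ^ c) →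
    ∀ (d : Fin K → ℕ) (S : Fin K → Matrix (Fin m) (Fin m) ℝ), (∀ l, (S l).IsSymm) →
      IsFullPosRooted (pencil d S).det → (2 * (pencil d S).det.natDegree) ^ 2 ≤ 2 ^ (K * Nat.log 2 K)

/-! ## Appended 2026-08-28 (val-sym-eng-3 g3, «stamp» port, desk pub-symmetroid R2437 (A)): the typed search target of line «stamp»
(`Cruxes/MatrixDescartes/Lines/stamp.lean`, val-idea-6 g3; val-idea-crit-1 VERDICT #23 = PASS, instrument tier) and its seven extremal
additive 2-bases (classical postage-stamp tables: Guy UPINT C12; OEIS A001212 `n(2,k) = 2,4,8,12,16,20,26,32,…`).  Nothing is claimed. -/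

/-- **Full realisability** of a support `d` at size `m` in degree `n` (line «stamp», verbatim): some symmetric `m × m`
half-pencil on `d` has a full-positive-rooted determinant of degree exactly `n` — the typed SEARCH TARGET of the engines
(`G6`–`G9` of the workfile are `FullyRealisable 2 dA5 16`, `… dA6 20`, `… dA7a/b/c 26`, `… dA8a/b 32`; none is asserted). [folklore] -/
def FullyRealisable (m : ℕ) {K : ℕ} (d : Fin K → ℕ) (n : ℕ) : Prop :=
  ∃ S : Fin K → Matrix (Fin m) (Fin m) ℝ, (∀ l, (S l).IsSymm) ∧
    IsFullPosRooted (pencil d S).det ∧ (pencil d S).det.natDegree = n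

/-- `{0} ∪ A₅`, `A₅ = {1,3,5,7,8}`: the unique extremal additive 2-basis with 5 denominations, `n(2,5) = 16`. [folklore] -/
def dA5 : Fin 6 → ℕ := ![0, 1, 3, 5, 7, 8]

/-- `{0} ∪ {1,3,5,7,9,10}`: one of the five extremal 2-bases with 6 denominations, `n(2,6) = 20`. [folklore] -/
def dA6 : Fin 7 → ℕ := ![0, 1, 3, 5, 7, 9, 10]

/-- `{0} ∪ {1,3,5,7,8,17,18}`: extremal `A₇`, `n(2,7) = 26`. [folklore] -/
def dA7a : Fin 8 → ℕ := ![0, 1, 3, 5, 7, 8, 17, 18]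

/-- `{0} ∪ {1,3,4,9,10,12,13}`: extremal `A₇`, `n(2,7) = 26`. [folklore] -/
def dA7b : Fin 8 → ℕ := ![0, 1, 3, 4, 9, 10, 12, 13]

/-- `{0} ∪ {1,2,5,8,11,12,13}`: extremal `A₇`, `n(2,7) = 26`. [folklore] -/
def dA7c : Fin 8 → ℕ := ![0, 1, 2, 5, 8, 11, 12, 13]

/-- `{0} ∪ {1,3,5,7,9,10,21,22}`: extremal `A₈`, `n(2,8) = 32`. [folklore] -/
def dA8a : Fin 9 → ℕ := ![0, 1, 3, 5, 7, 9, 10, 21, 22]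

/-- `{0} ∪ {1,2,5,8,11,14,15,16}`: extremal `A₈`, `n(2,8) = 32`. [folklore] -/
def dA8b : Fin 9 → ℕ := ![0, 1, 2, 5, 8, 11, 14, 15, 16]

end Summit.ValiantsHypothesis.ValiantsHypothesis.Theorems.LacunarySymmetroidMatrixDescartes.FiniteSector

end
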